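import Literature.NumberTheory.PAdicHodge.LubinTateLangLimit
import HarnessLib

/-!
# LubinTateFrobeniusOrbitNorm — norms along the `π`-division tower of a Lubin–Tate polynomial and
# along the orbit of a Frobenius power of a division point (solo-Langlands-informed s112, Stage E2.0)

Pure ultrametric estimates in a nonarchimedean normed field `K`, for the Lubin–Tate polynomial
`P(z) = ρ z + z^q` (`LangLimit.ltMap ρ q`) and a `ϖ`-division tower `t` of `ϖ X + X^q`
(`t 0 = 0`, `ϖ t_{n+1} + t_{n+1}^q = t_n`, `t 1 ≠ 0`) with `‖ρ‖ = ‖ϖ‖ < 1`: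

* §1 the two phases of `P`: `‖P(z)‖ = ‖z‖^q` when `‖ρ‖ < ‖z‖^{q-1}` (the power dominates; the linear phase
  `‖P(z)‖ = ‖ρ‖‖z‖` for `‖z‖^{q-1} < ‖ρ‖` is `LangLimit.norm_ltMap`);
* §2 the classical valuations of division points: `‖t_1‖^{q-1} = ‖ϖ‖`, `‖t_{m+1}‖^q = ‖t_m‖` and
  `‖t_{m+1}‖^{q^m} = ‖t_1‖` (Lang: `x_n^{p^n} ∼ x_0`, `x_0^{p-1} = -π`);
* §3 ★ the **Frobenius-orbit norm lemma**: for an exponent `N` with `2 ≤ N < q` (in the application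
  `N = p^j`, `0 < j < f`, `q = p^f`), every `m ≥ 1` and every `z` with `‖z‖ = ‖t_m‖^N`,
  `‖Pᵐ(z)‖ = ‖ρ‖ · ‖t_1‖^N`.  Along the orbit the power `X^q` strictly dominates for the first `m - 1`
  steps (the norms visited, `‖t_{m-i}‖^N`, never equal the critical value `‖t_1‖` because `N` is not a
  power of `q`), and the last step is linear because `N ≥ 2`; in particular the value depends on `‖z‖`
  only, so a perturbation of `t_m^N` of norm `< ‖t_m‖^N` does not change it.  This is the non-vanishing
  input for the Frobenius-twisted specialisations `ϑ_τ = (θ ∘ φ^j) ⊗ τ` of Fontaine's element of the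
  division tower (hypothesis (H) of the rank-one de Rham ⇒ Hodge–Tate files for `p`-adic fields of residue
  degree `f ≥ 2`, scope memo STAGE_E2_SCOPE.md): `ϑ_τ` of a lift of `t_m` is `t_m^{p^j}` up to an error of
  norm `≤ ‖p‖ < ‖t_m‖^{p^j}` for `m` large.

## References
* [LangCyclotomic1990] S. Lang, *Cyclotomic Fields I and II*, GTM 121 (1990), Ch. 8 §5 (orders of the
  division points in the proof following Thm. 5.2, PDF p. 147: `x_n^{p^n} ∼ x_0`, `x_0^{p-1} = -π`) and §6
  Lemma 3 (PDF p. 149: the valuation of `π_A^n(x)`).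
* [CasselsFrohlichANT1967] J.-P. Serre, *Local class field theory*, in Cassels–Fröhlich (1967), Ch. VI §3.3.
-/

noncomputable section

open Filter
open _root_.Topology

namespace Literature.NumberTheory.PAdicHodge

namespace LangLimit

variable {K : Type*} [NormedField K] [IsUltrametricDist K] {q : ℕ} {ρ ϖ : K}

/-! ## §1 The power phase of `P` -/

/-- **`‖P(z)‖ = ‖z‖^q` for `‖ρ‖ < ‖z‖^{q-1}`** (the term `z^q` dominates).
[cite: LangCyclotomic1990, Ch. 8 §5, proof following Thm. 5.2] -/
theorem norm_ltMap_of_lt (hq : 2 ≤ q) {z : K} (hz : ‖ρ‖ < ‖z‖ ^ (q - 1)) :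
    ‖ltMap ρ q z‖ = ‖z‖ ^ q := by
  have hzpos : 0 < ‖z‖ := by
    rcases (norm_nonneg z).eq_or_lt with h | h
    · exfalso; rw [← h, zero_pow (by omega)] at hz; exact (not_lt.2 (norm_nonneg ρ)) hz
    · exact h
  have hlt : ‖ρ * z‖ < ‖z ^ q‖ := by
    rw [norm_pow, norm_mul, ← pow_sub_one_mul (by omega : q ≠ 0) ‖z‖]
    exact mul_lt_mul_of_pos_right hz hzpos
  rw [ltMap, IsUltrametricDist.norm_add_eq_max_of_norm_ne_norm (ne_of_lt hlt), max_eq_right hlt.le,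
    norm_pow]

/-! ## §2 Norms along a `ϖ`-division tower of `ϖ X + X^q` -/

section Tower

variable {t : ℕ → K}

omit [IsUltrametricDist K] in
/-- **`‖t_1‖^{q-1} = ‖ϖ‖`** for a nonzero root `t_1` of `ϖ X + X^q` (`t_1^{q-1} = -ϖ`).
[cite: LangCyclotomic1990, Ch. 8 §5, proof following Thm. 5.2] -/
theorem norm_tower_one_pow (hq : 2 ≤ q) (ht1 : ϖ * t 1 + t 1 ^ q = 0) (h0 : t 1 ≠ 0) :
    ‖t 1‖ ^ (q - 1) = ‖ϖ‖ := by
  have h : t 1 ^ (q - 1) = -ϖ := by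
    have h' : t 1 * (ϖ + t 1 ^ (q - 1)) = 0 := by
      rw [mul_add, mul_comm, ← pow_succ', Nat.sub_add_cancel (by omega)]; exact ht1
    rcases mul_eq_zero.1 h' with h'' | h''
    · exact absurd h'' h0
    · exact eq_neg_of_add_eq_zero_right h''
  rw [← norm_pow, h, norm_neg]

omit [IsUltrametricDist K] in
/-- `0 < ‖t_1‖ < 1` for a nonzero root of `ϖ X + X^q` with `‖ϖ‖ < 1`.
[cite: LangCyclotomic1990, Ch. 8 §5, proof following Thm. 5.2] -/
theorem norm_tower_one_lt_one (hq : 2 ≤ q) (hϖ : ‖ϖ‖ < 1) (ht1 : ϖ * t 1 + t 1 ^ q = 0) (h0 : t 1 ≠ 0) :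
    ‖t 1‖ < 1 := by
  by_contra h
  have h1 : 1 ≤ ‖t 1‖ ^ (q - 1) := one_le_pow₀ (not_lt.1 h)
  rw [norm_tower_one_pow hq ht1 h0] at h1
  exact (not_lt.2 h1) hϖ

/-- **Valuations of the division points**: for `m ≥ 1`, `‖t_{m+1}‖^q = ‖t_m‖` and `‖t_1‖ < ‖t_{m+1}‖`
(the power `X^q` strictly dominates in `ϖ t_{m+1} + t_{m+1}^q = t_m`).
[cite: LangCyclotomic1990, Ch. 8 §5, proof following Thm. 5.2] -/
theorem norm_tower_succ (hq : 2 ≤ q) (hϖ : ‖ϖ‖ < 1) (ht : ∀ n, ϖ * t (n + 1) + t (n + 1) ^ q = t n)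
    (ht0 : t 0 = 0) (h0 : t 1 ≠ 0) :
    ∀ m, 1 ≤ m → ‖t (m + 1)‖ ^ q = ‖t m‖ ∧ ‖t 1‖ < ‖t (m + 1)‖ := by
  have ht1 : ϖ * t 1 + t 1 ^ q = 0 := by rw [ht 0, ht0]
  have hpow := norm_tower_one_pow hq ht1 h0
  have h1pos : 0 < ‖t 1‖ := norm_pos_iff.2 h0
  -- the key step: if `‖t 1‖ ≤ ‖t m‖` then `X^q` dominates at level `m + 1`
  have key : ∀ m, ‖t 1‖ ≤ ‖t m‖ → ‖t (m + 1)‖ ^ q = ‖t m‖ ∧ ‖t 1‖ < ‖t (m + 1)‖ := by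
    intro m hm
    have hlt : ‖t 1‖ < ‖t (m + 1)‖ := by
      by_contra h
      have h' : ‖t (m + 1)‖ ≤ ‖t 1‖ := not_lt.1 h
      -- then both terms of `ϖ t_{m+1} + t_{m+1}^q` have norm `≤ ‖ϖ‖ ‖t 1‖ < ‖t 1‖ ≤ ‖t m‖`
      have hA : ‖ϖ * t (m + 1)‖ ≤ ‖ϖ‖ * ‖t 1‖ := by
        rw [norm_mul]; exact mul_le_mul_of_nonneg_left h' (norm_nonneg _)
      have hB : ‖t (m + 1) ^ q‖ ≤ ‖ϖ‖ * ‖t 1‖ := by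
        rw [norm_pow, ← pow_sub_one_mul (by omega : q ≠ 0), ← hpow]
        exact mul_le_mul (pow_le_pow_left₀ (norm_nonneg _) h' _) h' (norm_nonneg _)
          (pow_nonneg (norm_nonneg _) _)
      have hC : ‖t m‖ ≤ ‖ϖ‖ * ‖t 1‖ := by
        rw [← ht m]; exact (IsUltrametricDist.norm_add_le_max _ _).trans (max_le hA hB)
      have hD : ‖ϖ‖ * ‖t 1‖ < ‖t 1‖ := mul_lt_of_lt_one_left h1pos hϖ
      exact (not_lt.2 (hm.trans hC)) hD
    refine ⟨?_, hlt⟩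
    have hdom : ‖ϖ‖ < ‖t (m + 1)‖ ^ (q - 1) := by
      rw [← hpow]; exact pow_lt_pow_left₀ hlt (norm_nonneg _) (by omega)
    have := norm_ltMap_of_lt (ρ := ϖ) hq hdom
    rw [ltMap, ht m] at this
    exact this.symm
  -- induction on `m ≥ 1`, carrying `‖t 1‖ ≤ ‖t m‖`
  have aux : ∀ m, 1 ≤ m → ‖t 1‖ ≤ ‖t m‖ := by
    intro m hm
    induction m with
    | zero => omega
    | succ m ih =>
      rcases Nat.eq_zero_or_pos m with rfl | hmpos
      · exact le_rfl
      · exact (key m (ih hmpos)).2.le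
  exact fun m hm => key m (aux m hm)

/-- **`‖t_{m+1}‖^{q^m} = ‖t_1‖`** (`ord t_{m+1} = ord t_1 / q^m`).
[cite: LangCyclotomic1990, Ch. 8 §5, proof following Thm. 5.2] -/
theorem norm_tower_pow_pow (hq : 2 ≤ q) (hϖ : ‖ϖ‖ < 1) (ht : ∀ n, ϖ * t (n + 1) + t (n + 1) ^ q = t n)
    (ht0 : t 0 = 0) (h0 : t 1 ≠ 0) (m : ℕ) : ‖t (m + 1)‖ ^ (q ^ m) = ‖t 1‖ := by
  induction m with
  | zero => simp
  | succ m ih =>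
    rw [pow_succ', pow_mul, (norm_tower_succ hq hϖ ht ht0 h0 (m + 1) (by omega)).1, ih]

/-- `0 < ‖t_{m+1}‖ < 1` along the tower. [cite: LangCyclotomic1990, Ch. 8 §5, proof following Thm. 5.2] -/
theorem norm_tower_succ_lt_one (hq : 2 ≤ q) (hϖ : ‖ϖ‖ < 1)
    (ht : ∀ n, ϖ * t (n + 1) + t (n + 1) ^ q = t n) (ht0 : t 0 = 0) (h0 : t 1 ≠ 0) (m : ℕ) :
    0 < ‖t (m + 1)‖ ∧ ‖t (m + 1)‖ < 1 := by
  have ht1 : ϖ * t 1 + t 1 ^ q = 0 := by rw [ht 0, ht0]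
  have h1 := norm_tower_one_lt_one hq hϖ ht1 h0
  have h1pos : 0 < ‖t 1‖ := norm_pos_iff.2 h0
  have hpp := norm_tower_pow_pow hq hϖ ht ht0 h0 m
  refine ⟨?_, ?_⟩
  · rcases (norm_nonneg (t (m + 1))).eq_or_lt with h | h
    · exfalso; rw [← h, zero_pow (pow_ne_zero _ (by omega))] at hpp; exact h1pos.ne hpp
    · exact h
  · by_contra h
    have : 1 ≤ ‖t (m + 1)‖ ^ (q ^ m) := one_le_pow₀ (not_lt.1 h)
    rw [hpp] at this
    exact (not_lt.2 this) h1

/-! ## §3 ★ The Frobenius-orbit norm lemma -/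

/-- ★ **Frobenius-orbit norm lemma.** Let `‖ρ‖ = ‖ϖ‖ < 1`, `t` a `ϖ`-division tower of `ϖ X + X^q` with
`t_1 ≠ 0`, and `2 ≤ N < q`.  For every `m ≥ 1` and every `z` with `‖z‖ = ‖t_m‖^N`,
`‖Pᵐ(z)‖ = ‖ρ‖ · ‖t_1‖^N` where `P(z) = ρ z + z^q`: the power `X^q` strictly dominates for `m - 1` steps
(`‖t_1‖ < ‖t_{i+1}‖^N` since `N < q ≤ q^i`), after which `‖P^{m-1}(z)‖ = ‖t_1‖^N < ‖t_1‖` and the last step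
is linear (`LangLimit.norm_ltMap`).  Used with `N = p^j` for the Frobenius twists `θ ∘ φ^j`.
[cite: LangCyclotomic1990, Ch. 8 §5 (proof following Thm. 5.2) and §6 Lemma 3] -/
theorem norm_ltMap_iterate_of_norm_eq_tower_pow (hq : 2 ≤ q) (hρ : ‖ρ‖ = ‖ϖ‖) (hϖ : ‖ϖ‖ < 1)
    (ht : ∀ n, ϖ * t (n + 1) + t (n + 1) ^ q = t n) (ht0 : t 0 = 0) (h0 : t 1 ≠ 0)
    {N : ℕ} (hN2 : 2 ≤ N) (hNq : N < q) :
    ∀ m, 1 ≤ m → ∀ z : K, ‖z‖ = ‖t m‖ ^ N → ‖(ltMap ρ q)^[m] z‖ = ‖ρ‖ * ‖t 1‖ ^ N := by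
  have ht1 : ϖ * t 1 + t 1 ^ q = 0 := by rw [ht 0, ht0]
  have hpow := norm_tower_one_pow hq ht1 h0
  have h1 := norm_tower_one_lt_one hq hϖ ht1 h0
  have h1pos : 0 < ‖t 1‖ := norm_pos_iff.2 h0
  intro m hm
  induction m with
  | zero => omega
  | succ m ih =>
    intro z hz
    rcases Nat.eq_zero_or_pos m with rfl | hmpos
    · -- the linear step: `‖z‖ = ‖t 1‖^N < ‖t 1‖`
      have hzlt : ‖z‖ < ‖t 1‖ := by
        rw [hz]; exact pow_lt_self_of_lt_one₀ h1pos h1 (by omega)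
      have hreg : ‖z‖ ^ (q - 1) < ‖ρ‖ := by
        rw [hρ, ← hpow]; exact pow_lt_pow_left₀ hzlt (norm_nonneg _) (by omega)
      rw [Function.iterate_one, norm_ltMap hq hreg, hz]
    · -- a power step: `‖z‖ = ‖t (m+1)‖^N > ‖t 1‖`, so `‖P z‖ = ‖z‖^q = ‖t m‖^N`
      obtain ⟨hmpos', hmlt⟩ := norm_tower_succ_lt_one hq hϖ ht ht0 h0 m
      have hgt : ‖t 1‖ < ‖z‖ := by
        rw [hz, ← norm_tower_pow_pow hq hϖ ht ht0 h0 m]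
        exact pow_lt_pow_right_of_lt_one₀ hmpos' hmlt
          (lt_of_lt_of_le hNq (by simpa using Nat.pow_le_pow_right (by omega : 0 < q) hmpos))
      have hdom : ‖ρ‖ < ‖z‖ ^ (q - 1) := by
        rw [hρ, ← hpow]; exact pow_lt_pow_left₀ hgt (norm_nonneg _) (by omega)
      have hPz : ‖ltMap ρ q z‖ = ‖t m‖ ^ N := by
        rw [norm_ltMap_of_lt hq hdom, hz, ← pow_mul, mul_comm, pow_mul,
          (norm_tower_succ hq hϖ ht ht0 h0 m hmpos).1]
      rw [Function.iterate_succ_apply]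
      exact ih hmpos _ hPz

/-- ★ **Perturbed form.** With the hypotheses of `norm_ltMap_iterate_of_norm_eq_tower_pow`, for `m ≥ 1` and
any `δ` with `‖δ‖ < ‖t_m‖^N`: `‖Pᵐ(t_m^N + δ)‖ = ‖ρ‖ · ‖t_1‖^N` (in particular `Pᵐ(t_m^N + δ) ≠ 0`).
[cite: LangCyclotomic1990, Ch. 8 §5 (proof following Thm. 5.2) and §6 Lemma 3] -/
theorem norm_ltMap_iterate_tower_pow_add (hq : 2 ≤ q) (hρ : ‖ρ‖ = ‖ϖ‖) (hϖ : ‖ϖ‖ < 1)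
    (ht : ∀ n, ϖ * t (n + 1) + t (n + 1) ^ q = t n) (ht0 : t 0 = 0) (h0 : t 1 ≠ 0)
    {N : ℕ} (hN2 : 2 ≤ N) (hNq : N < q) {m : ℕ} (hm : 1 ≤ m) {δ : K} (hδ : ‖δ‖ < ‖t m‖ ^ N) :
    ‖(ltMap ρ q)^[m] (t m ^ N + δ)‖ = ‖ρ‖ * ‖t 1‖ ^ N := by
  refine norm_ltMap_iterate_of_norm_eq_tower_pow hq hρ hϖ ht ht0 h0 hN2 hNq m hm _ ?_
  have hδ' : ‖δ‖ < ‖t m ^ N‖ := by rwa [norm_pow]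
  rw [IsUltrametricDist.norm_add_eq_max_of_norm_ne_norm (ne_of_gt hδ'), max_eq_left hδ'.le, norm_pow]

omit [IsUltrametricDist K] in
/-- The Lang regime for the orbit value: `(‖ρ‖‖t_1‖^N)^{q-1} < ‖ρ‖` (so `LangLimit.langLog_ne_zero`,
`map_langLog`, `langLog_eq_mul` apply to `y₀` with `‖y₀‖ = ‖ρ‖‖t_1‖^N`).
[cite: LangCyclotomic1990, Ch. 8 §6 Lemma 3] -/
theorem tower_pow_regime (hq : 2 ≤ q) (hρ : ‖ρ‖ = ‖ϖ‖) (hϖ : ‖ϖ‖ < 1)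
    (ht1 : ϖ * t 1 + t 1 ^ q = 0) (h0 : t 1 ≠ 0) {N : ℕ} (hN : 1 ≤ N) :
    (‖ρ‖ * ‖t 1‖ ^ N) ^ (q - 1) < ‖ρ‖ := by
  have h1 := norm_tower_one_lt_one hq hϖ ht1 h0
  have h1pos : 0 < ‖t 1‖ := norm_pos_iff.2 h0
  have hρpos : 0 < ‖ρ‖ := by rw [hρ, ← norm_tower_one_pow hq ht1 h0]; exact pow_pos h1pos _
  have hρ1 : ‖ρ‖ < 1 := hρ ▸ hϖ
  have hA : (‖ρ‖ * ‖t 1‖ ^ N) ^ (q - 1) < ‖ρ‖ ^ (q - 1) := by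
    apply pow_lt_pow_left₀ _ (mul_nonneg (norm_nonneg _) (pow_nonneg (norm_nonneg _) _)) (by omega)
    exact mul_lt_of_lt_one_right hρpos (pow_lt_one₀ (norm_nonneg _) h1 (by omega))
  exact hA.trans_le (pow_le_of_le_one (norm_nonneg _) hρ1.le (by omega))

end Tower

/-! ## §4 Norm of a limit with eventually constant norm -/

omit [IsUltrametricDist K] in
/-- In a normed group, the limit of a sequence whose norms are eventually equal to `c` has norm `c`. [folklore] -/
private theorem norm_eq_of_tendsto_of_eventually {u : ℕ → K} {y : K} {c : ℝ}
    (hu : Tendsto u atTop (𝓝 y)) (hc : ∀ᶠ n in atTop, ‖u n‖ = c) : ‖y‖ = c :=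
  tendsto_nhds_unique hu.norm (tendsto_const_nhds.congr' (hc.mono fun _ hn => hn.symm))

omit [IsUltrametricDist K] in
/-- **Norm of a limit along the orbit**: if `u_n → y` and `‖u_n‖ = ‖ρ‖‖t_1‖^N` for all large `n`, then
`‖y‖ = ‖ρ‖‖t_1‖^N`; in particular `y ≠ 0` when `ρ ≠ 0` and `t_1 ≠ 0`.
[cite: LangCyclotomic1990, Ch. 8 §6 Lemma 3] -/
theorem norm_eq_of_tendsto_orbit {u : ℕ → K} {y : K} {t₁ : K} {N : ℕ}
    (hu : Tendsto u atTop (𝓝 y)) (hc : ∀ᶠ n in atTop, ‖u n‖ = ‖ρ‖ * ‖t₁‖ ^ N)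
    (hρ0 : ρ ≠ 0) (h0 : t₁ ≠ 0) : ‖y‖ = ‖ρ‖ * ‖t₁‖ ^ N ∧ y ≠ 0 := by
  have h := norm_eq_of_tendsto_of_eventually hu hc
  refine ⟨h, fun hy => ?_⟩
  rw [hy, norm_zero] at h
  exact (mul_pos (norm_pos_iff.2 hρ0) (pow_pos (norm_pos_iff.2 h0) N)).ne h

end LangLimit

end Literature.NumberTheory.PAdicHodge

end
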